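import Literature.NumberTheory.GaloisRepresentations.ContinuousShapiroLiftMackeyCup
import Literature.NumberTheory.GaloisRepresentations.ContinuousShapiroOpenCoinducedDescent
import HarnessLib

/-!
# The UNIT `X → Maps(G ⧸ N, X)` and the TRACE `Maps(G ⧸ N, X) → X` under the Shapiro lift:
# `Sh_N(res a) = u_* a`, `r_* (Sh_N b) = cor b`, the Mackey components of `u_* a'` along `θ : D → G`, and the
# adjunction `⟨u_* a', F⟩_{ΣP} = ⟨a', r_* F⟩_P` — hence `⟨u_* a', θ^*(Sh_N b)⟩_{ΣP} = ⟨a', θ^*(cor b)⟩_P`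

Generic continuous group cohomology (no number theory); namespace `Literature.NumberTheory.GaloisRepresentations`.
THEOREMS ONLY (no definition, no named fact, no instance, no notation, no `sorry`). Sequel of
`ContinuousShapiroLift.lean` / `…Cores.lean` / `…Pairing.lean` / `…MackeyCup.lean` (the Shapiro lift
`Sh_N : H¹(N, X) → H¹(G, Maps(G ⧸ N, X))`, the transfer `cores`, the summed pairing `P.coindFin N` and the Mackey
projections `Φ_c = resCoindFinHomR`) and of `ContinuousShapiroOpenCoinducedDescent.lean` (the unit `u = coindOpenUnit`,
constant functions, and the trace `r = coindOpenTrace`, `φ ↦ Σ_y φ(y)`, of a discrete module over a compact group).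

Let `G` be a topological group, `N ≤ G` an open subgroup with representatives `s` (`s(1·N) = 1`), `X : TopRep R G`.
Call a morphism `u : X ⟶ Maps(G ⧸ N, X)` a UNIT if `(u x)(y) = x` for all `y` (constant functions), and a morphism
`r : Maps(G ⧸ N, X) ⟶ X` a TRACE if `r ψ = Σ_y ψ(y)`; both are taken HYPOTHESIS-STYLE (any morphisms with these values,
over `G` or over a group `D` mapping to `G` by `θ`), so that the statements apply verbatim to `coindOpenUnit` /
`coindOpenTrace` and to their restrictions along a decomposition map `θ : Γ_v → Γ_K` written with `TopRep.res`.

* §1 **`shapiroLift_resSubgroup_of_const`**: `Sh_N(res^G_N a) = H¹(u) a` for `a ∈ H¹(G, X)` (on cocycles the evaluation of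
  `u ∘ f` at the unit coset is `f|_N`; `shapiroLift_oneCocycleClass_evalOne`); discrete-module form
  `ContinuousRep.shapiroLift_resSubgroup_eq_cohomologyMap_coindOpenUnit`.
* §2 **`cohomologyMap_resCoindFinHomR_cohomologyMap_of_const`**: along `θ : D →ₜ* G`, EVERY Mackey component of the
  push-forward `H¹(u_θ) a'` of a class `a' ∈ H¹(D, X|_θ)` is the Shapiro lift of its restriction:
  `H¹(Φ_c)(H¹(u_θ) a') = Sh^D_{θ⁻¹N}(res a')` for every `c ∈ G ⧸ N` (`Φ_c ∘ u_θ` is again a unit; §1 over `D`) — a local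
  class with ALL place components prescribed EQUAL (Brown III (5.6)(b)).
* §3 **`cohomologyMap_of_sum_shapiroLift`**: `H¹(r)(Sh_N b) = cor b` (`cores`; on cocycles the fibre sum of the Shapiro
  lift IS the transfer, `sum_shapiroCocycle_apply`) — the degree-one, permutation-model form of Serre's
  `cor = H(norm) ∘ sh⁻¹` (the tree's all-degree `ContinuousRep.cor_shapiroCoindFinAddEquiv` in the inverse direction);
  along `θ`: `cohomologyMap_of_sum_map_shapiroLift` (`r_* θ^*(Sh_N b) = θ^*(cor b)`, with arbitrary comparison
  morphisms `jC`, `jX` for the restricted coefficient objects); discrete-module form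
  `ContinuousRep.cohomologyMap_coindOpenTrace_shapiroLift`.
* §4 pairings `P : X × Y → Z`: the module identity `⟨u x, ψ⟩_{ΣP} = ⟨x, Σ_y ψ(y)⟩_P` (`ContPairing.coindFin_toLin_of_const`),
  the ADJUNCTION **`ContPairing.cupProduct_coindFin_of_const`** `H¹(u) a ∪_{ΣP} F = a ∪_P H¹(r) F` (over `G`) and
  **`ContPairing.cupProduct_coindFin_restrict_of_const`** (over `D` along `θ`, pairings `(P.coindFin N).restrict θ` /
  `P.restrict θ`) — the tree's mixed naturality `cupProduct_map_adjoint` for the pair (unit, trace) — and the headline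
  **`ContPairing.cupProduct_const_map_shapiroLift`**: `H¹(u_θ) a' ∪_{ΣP|_θ} θ^*(Sh_N b) = a' ∪_{P|_θ} θ^*(cor b)` for a LOCAL
  class `a' ∈ H¹(D, X|_θ)` and a LAYER class `b ∈ H¹(N, Y)` (Neukirch–Schmidt–Wingberg (1.5.3)(iv) read at a place).

Consumer (why). Poitou–Tate over a number field `K` in the Shapiro model of a layer `K_n` (`G = Γ_K`, `N = Γ_n`,
`D = Γ_{K_v}`): the local class at an auxiliary place `v₀` with all components above `v₀` PRESCRIBED EQUAL to `res z̃` is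
`u_* z̃` (§2), and its Poitou–Tate local term against a dual class `Ψ Sh b` is the level-`0` local Tate pairing
`⟨z̃, loc_{v₀}(cor b)⟩_{v₀}` (§4 with `LayerPairingNondegenerate.localTatePairing_coind_cohomologyMap_eq_cupProduct_restrict`)
— the obstruction side of the kernel proof of Greenberg's Lemma 4.6 on `Γ`-invariants
(`Greenberg1999.lemma46_gammaInvariants_auxPlace_rat`; cell `bsd-2adic`, item stmt-BirchSwinnertonDyer-19271, seat
`bsd-2adic-tower-1` GEN 34). HONEST FRAMING: bookkeeping of continuous cohomology; nothing arithmetic is proved here.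

## References
* J. Neukirch, A. Schmidt, K. Wingberg, *Cohomology of Number Fields*, 2nd ed. (2008), I §5 Prop. (1.5.3)(iv)
  (projection formula), (1.5.6)–(1.5.7) (double cosets), I §6 Prop. (1.6.4) (Shapiro). [NeukirchSchmidtWingberg2008]
* K. S. Brown, *Cohomology of Groups* (1982), III §5 (5.6)(b), III (6.5). [Brown1982]
* J.-P. Serre, *Galois Cohomology* (1997), I §2.5 (induced modules, `cor`). [SerreGaloisCohomology1997]
-/

noncomputable section

open CategoryTheory

universe u v

namespace Literature.NumberTheory.GaloisRepresentations

open _root_.TopRep _root_.ContinuousCohomology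

/-! ## §1 The Shapiro lift of a restricted class is the push-forward along a unit -/

section Unit

variable {R : Type u} [CommRing R] [TopologicalSpace R]
variable {G : Type v} [Group G] [TopologicalSpace G] [IsTopologicalGroup G]
variable (X : TopRep.{v} R G) (N : Subgroup G) (hN : IsOpen (N : Set G)) {s : G ⧸ N → G}
  (hs : ∀ x : G ⧸ N, (s x : G ⧸ N) = x) (hs1 : s ((1 : G) : G ⧸ N) = 1)

/-- **`Sh_N(res^G_N a) = H¹(u) a`** for every unit `u : X ⟶ Maps(G ⧸ N, X)` (constant functions: `(u x)(y) = x`) and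
`a ∈ H¹(G, X)`: on cocycles, the evaluation of `u ∘ f` at the unit coset is the restriction `f|_N`, and the Shapiro lift
on classes is the inverse of that evaluation (`shapiroLift_oneCocycleClass_evalOne`).
[cite: NeukirchSchmidtWingberg2008, I §6 Prop. (1.6.4)] -/
theorem shapiroLift_resSubgroup_of_const (u : X ⟶ coindFin X N) (hu : ∀ (x : X) (y : G ⧸ N), u.hom x y = x)
    (a : continuousCohomology 1 X) :
    shapiroLift X N hN hs hs1 (resSubgroup X N 1 a) = cohomologyMap u 1 a := by
  obtain ⟨f, rfl⟩ := oneCocycleClass_surjective _ a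
  rw [cohomologyMap_oneCocycleClass, resSubgroup_oneCocycleClass]
  have h : contOneCocycles.pullback (subgroupSubtypeHom N) (Y := subgroupRep X N)
        (TopRep.ofHom ⟨ContinuousLinearMap.id R X, fun _ => rfl⟩) f =
      evalOne X N (contOneCocycles.pullback (ContinuousMonoidHom.id G) (resIdHom u) f) := by
    refine Subtype.ext (ContinuousMap.ext fun n => ?_)
    rw [evalOne_apply, pullback_id_resIdHom_apply, hu, resSubgroup_pullback_apply]
  rw [h, shapiroLift_oneCocycleClass_evalOne]

end Unit

section UnitDiscrete

variable {G : Type u} [Group G] [TopologicalSpace G] [IsTopologicalGroup G] [CompactSpace G]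
variable {M : Type u} [AddCommGroup M] [TopologicalSpace M] [DiscreteTopology M]
variable (ρ : ContinuousRep G ℤ M) (N : Subgroup G) (hN : IsOpen (N : Set G)) {s : G ⧸ N → G}
  (hs : ∀ x : G ⧸ N, (s x : G ⧸ N) = x) (hs1 : s ((1 : G) : G ⧸ N) = 1)

/-- **`Sh_N(res^G_N a) = H¹(u) a`** for the unit `u = coindOpenUnit` (constant functions) of a discrete module over a
compact group. [cite: NeukirchSchmidtWingberg2008, I §6 Prop. (1.6.4)] -/
theorem ContinuousRep.shapiroLift_resSubgroup_eq_cohomologyMap_coindOpenUnit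
    (a : continuousCohomology 1 ρ.toTopRep) :
    shapiroLift ρ.toTopRep N hN hs hs1 (resSubgroup ρ.toTopRep N 1 a) =
      cohomologyMap (ρ.coindOpenUnit N hN : ρ.toTopRep ⟶ coindFin.{0, u} ρ.toTopRep N) 1 a :=
  shapiroLift_resSubgroup_of_const ρ.toTopRep N hN hs hs1 _ (fun _ _ => rfl) a

end UnitDiscrete

/-! ## §2 Along `θ : D → G`: every Mackey component of `H¹(u_θ) a'` is `Sh^D(res a')` -/

section Components

variable {R : Type u} [CommRing R] [TopologicalSpace R]
variable {G : Type v} [Group G] [TopologicalSpace G] [IsTopologicalGroup G]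
variable {D : Type v} [Group D] [TopologicalSpace D] [IsTopologicalGroup D]
variable (X : TopRep.{v} R G) (N : Subgroup G) [N.Normal] (θ : D →ₜ* G) (hN : IsOpen (N : Set G))
  {sD : D ⧸ N.comap (θ : D →* G) → D} (hsD : ∀ y, (sD y : D ⧸ N.comap (θ : D →* G)) = y)
  (hsD1 : sD ((1 : D) : D ⧸ N.comap (θ : D →* G)) = 1)

omit [IsTopologicalGroup G] in
/-- **All Mackey components of the push-forward of a local class along a unit are the Shapiro lift of its restriction.**
For `θ : D →ₜ* G`, a unit `u_θ : X|_θ ⟶ Maps(G ⧸ N, X)|_θ` over `D` (`(u_θ x)(y) = x`), `a' ∈ H¹(D, X|_θ)` and EVERY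
`c ∈ G ⧸ N`: `H¹(Φ_c)(H¹(u_θ) a') = Sh^D_{θ⁻¹N}(res^D_{θ⁻¹N} a')`, `Φ_c = resCoindFinHomR` the projection onto the double coset
`θ(D)·c` (`Φ_c ∘ u_θ` is a unit of `D`, then §1 over `D`). In the arithmetic reading: the local class `u_* z̃` at a place
`v` has the SAME component `res z̃` at every place of the layer above `v`. [cite: Brown1982, III §5 (5.6)(b)]
[cite: NeukirchSchmidtWingberg2008, I §6 Prop. (1.6.4)] -/
theorem cohomologyMap_resCoindFinHomR_cohomologyMap_of_const
    (uθ : TopRep.res (θ : D →* G) X ⟶ TopRep.res (θ : D →* G) (coindFin X N))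
    (hu : ∀ (x : X) (y : G ⧸ N), (uθ.hom x : G ⧸ N → X) y = x) (c : G ⧸ N)
    (a' : continuousCohomology 1 (TopRep.res (θ : D →* G) X)) :
    cohomologyMap (resCoindFinHomR X N θ c) 1 (cohomologyMap uθ 1 a') =
      shapiroLift (TopRep.res (θ : D →* G) X) (N.comap (θ : D →* G)) (isOpen_comap N θ hN) hsD hsD1
        (resSubgroup (TopRep.res (θ : D →* G) X) (N.comap (θ : D →* G)) 1 a') := by
  rw [cohomologyMap_comp_apply_of_eq uθ (resCoindFinHomR X N θ c) (uθ ≫ resCoindFinHomR X N θ c) (fun _ => rfl),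
    shapiroLift_resSubgroup_of_const]
  intro x y'
  change (resCoindFinHomR X N θ c).hom (uθ.hom x) y' = x
  rw [resCoindFinHomR_apply]
  exact hu x _

end Components

/-! ## §3 The trace of a Shapiro lift is the corestriction -/

section Trace

variable {R : Type u} [CommRing R] [TopologicalSpace R]
variable {G : Type v} [Group G] [TopologicalSpace G] [IsTopologicalGroup G]
variable (X : TopRep.{v} R G) (N : Subgroup G) (hN : IsOpen (N : Set G)) [Fintype (G ⧸ N)] {s : G ⧸ N → G}
  (hs : ∀ x : G ⧸ N, (s x : G ⧸ N) = x) (hs1 : s ((1 : G) : G ⧸ N) = 1)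

/-- **`H¹(r)(Sh_N b) = cor b`** for every trace `r : Maps(G ⧸ N, X) ⟶ X` (`r ψ = Σ_y ψ(y)`) and `b ∈ H¹(N, X)`: on cocycles
the fibre sum of the Shapiro lift is the transfer on the nose (`sum_shapiroCocycle_apply`), and `cor [f] = [transfer f]`
(`cores_oneCocycleClass`). [cite: SerreGaloisCohomology1997, I §2.5 (corestriction)]
[cite: NeukirchSchmidtWingberg2008, I §5 Prop. (1.5.3)] -/
theorem cohomologyMap_of_sum_shapiroLift (r : coindFin X N ⟶ X)
    (hr : ∀ ψ : coindFin X N, r.hom ψ = ∑ y : G ⧸ N, (ψ : G ⧸ N → X) y)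
    (b : continuousCohomology 1 (subgroupRep X N)) :
    cohomologyMap r 1 (shapiroLift X N hN hs hs1 b) = cores X N hN b := by
  obtain ⟨f, rfl⟩ := oneCocycleClass_surjective _ b
  rw [shapiroLift_oneCocycleClass, cohomologyMap_oneCocycleClass, cores_oneCocycleClass X N hN hs]
  congr 1
  refine Subtype.ext (ContinuousMap.ext fun g => ?_)
  rw [pullback_id_resIdHom_apply, hr, transferCocycle_apply, sum_shapiroCocycle_apply]

variable {D : Type v} [Group D] [TopologicalSpace D] [IsTopologicalGroup D] (θ : D →ₜ* G)

/-- **`r_* θ^*(Sh_N b) = θ^*(cor b)` along `θ : D →ₜ* G`**, with arbitrary comparison morphisms for the restricted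
coefficient objects: for `jC : Maps(G ⧸ N, X)|_θ ⟶ C'`, `r : C' ⟶ X'`, `jX : X|_θ ⟶ X'` with `r (jC ψ) = jX (Σ_y ψ(y))`,
`H¹(r)(H¹(θ, jC)(Sh_N b)) = H¹(θ, jX)(cor b)` for every `b ∈ H¹(N, X)` (same cocycle computation as
`cohomologyMap_of_sum_shapiroLift`, evaluated at `θ d`). [cite: SerreGaloisCohomology1997, I §2.5 (corestriction)]
[cite: NeukirchSchmidtWingberg2008, I §5 Prop. (1.5.3)] -/
theorem cohomologyMap_of_sum_map_shapiroLift {C' X' : TopRep.{v} R D}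
    (jC : TopRep.res (θ : D →* G) (coindFin X N) ⟶ C') (r : C' ⟶ X') (jX : TopRep.res (θ : D →* G) X ⟶ X')
    (hr : ∀ ψ : coindFin X N, r.hom (jC.hom ψ) = jX.hom (∑ y : G ⧸ N, (ψ : G ⧸ N → X) y))
    (b : continuousCohomology 1 (subgroupRep X N)) :
    cohomologyMap r 1 (ContinuousCohomology.map θ jC 1 (shapiroLift X N hN hs hs1 b)) =
      ContinuousCohomology.map θ jX 1 (cores X N hN b) := by
  obtain ⟨f, rfl⟩ := oneCocycleClass_surjective _ b
  rw [shapiroLift_oneCocycleClass, map_oneCocycleClass, cohomologyMap_oneCocycleClass,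
    cores_oneCocycleClass X N hN hs, map_oneCocycleClass]
  congr 1
  refine Subtype.ext (ContinuousMap.ext fun d => ?_)
  rw [pullback_id_resIdHom_apply]
  change r.hom (jC.hom ((shapiroCocycle X N hN hs f).1 (θ d))) = jX.hom ((transferCocycle X N hN hs f).1 (θ d))
  rw [hr, transferCocycle_apply, sum_shapiroCocycle_apply]

end Trace

section TraceDiscrete

variable {G : Type u} [Group G] [TopologicalSpace G] [IsTopologicalGroup G] [CompactSpace G]
variable {M : Type u} [AddCommGroup M] [TopologicalSpace M] [DiscreteTopology M]
variable (ρ : ContinuousRep G ℤ M) (N : Subgroup G) (hN : IsOpen (N : Set G)) [Fintype (G ⧸ N)]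
  {s : G ⧸ N → G} (hs : ∀ x : G ⧸ N, (s x : G ⧸ N) = x) (hs1 : s ((1 : G) : G ⧸ N) = 1)

/-- **`H¹(coindOpenTrace)(Sh_N b) = cor b`** for a discrete module over a compact group and an open subgroup `N` of
finite index (the trace `φ ↦ Σ_y φ(y)` of `ContinuousShapiroOpenCoinducedDescent`).
[cite: SerreGaloisCohomology1997, I §2.5 (corestriction)] -/
theorem ContinuousRep.cohomologyMap_coindOpenTrace_shapiroLift (b : continuousCohomology 1 (subgroupRep ρ.toTopRep N)) :
    cohomologyMap (ρ.coindOpenTrace N hN : coindFin.{0, u} ρ.toTopRep N ⟶ ρ.toTopRep) 1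
        (shapiroLift ρ.toTopRep N hN hs hs1 b) = cores ρ.toTopRep N hN b :=
  cohomologyMap_of_sum_shapiroLift ρ.toTopRep N hN hs hs1 _ (fun _ => rfl) b

end TraceDiscrete

/-! ## §4 Pairings: the unit and the trace are adjoint under the summed pairing -/

namespace ContPairing

section PairingModule

variable {R : Type u} [CommRing R] [TopologicalSpace R]
variable {G : Type v} [Group G] [TopologicalSpace G] [IsTopologicalGroup G]
variable {X Y Z : TopRep.{v} R G} (P : ContPairing X Y Z) (N : Subgroup G) [Fintype (G ⧸ N)]

omit [TopologicalSpace G] [IsTopologicalGroup G] in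
/-- **`⟨φ, ψ⟩_{ΣP} = ⟨x, Σ_y ψ(y)⟩_P` for the constant function `φ ≡ x`** (the summed pairing of
`ContinuousShapiroLiftPairing.lean`). [cite: NeukirchSchmidtWingberg2008, I §5 Prop. (1.5.3)(iv)] -/
theorem coindFin_toLin_of_const (φ : _root_.Literature.NumberTheory.GaloisRepresentations.coindFin X N) (x : X)
    (hφ : ∀ y : G ⧸ N, (φ : G ⧸ N → X) y = x)
    (ψ : _root_.Literature.NumberTheory.GaloisRepresentations.coindFin Y N) :
    (P.coindFin N).toLin φ ψ = P.toLin x (∑ y : G ⧸ N, (ψ : G ⧸ N → Y) y) := by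
  rw [coindFin_toLin_apply, map_sum]
  exact Finset.sum_congr rfl fun y _ => by rw [hφ]

end PairingModule

section PairingGlobal

variable {R : Type u} [CommRing R] [TopologicalSpace R]
variable {G : Type v} [Group G] [TopologicalSpace G] [IsTopologicalGroup G] [LocallyCompactSpace G]
variable {X Y Z : TopRep.{v} R G} (P : ContPairing X Y Z) (N : Subgroup G) [Fintype (G ⧸ N)]

/-- **The unit and the trace are adjoint under the cup product**: `H¹(u) a ∪_{ΣP} F = a ∪_P H¹(r) F` for a unit
`u : X ⟶ Maps(G ⧸ N, X)`, a trace `r : Maps(G ⧸ N, Y) ⟶ Y`, `a ∈ H¹(G, X)`, `F ∈ H¹(G, Maps(G ⧸ N, Y))` (the tree's mixed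
naturality `cupProduct_map_adjoint` for `⟨u x, ψ⟩_{ΣP} = ⟨x, r ψ⟩_P`). [cite: NeukirchSchmidtWingberg2008, I §5 Prop. (1.5.3)(iv)] -/
theorem cupProduct_coindFin_of_const
    (u : X ⟶ _root_.Literature.NumberTheory.GaloisRepresentations.coindFin X N)
    (hu : ∀ (x : X) (y : G ⧸ N), (u.hom x : G ⧸ N → X) y = x)
    (r : _root_.Literature.NumberTheory.GaloisRepresentations.coindFin Y N ⟶ Y)
    (hr : ∀ ψ, r.hom ψ = ∑ y : G ⧸ N, (ψ : G ⧸ N → Y) y)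
    (a : continuousCohomology 1 X)
    (F : continuousCohomology 1 (_root_.Literature.NumberTheory.GaloisRepresentations.coindFin Y N)) :
    (P.coindFin N).cupProduct (cohomologyMap u 1 a) F = P.cupProduct a (cohomologyMap r 1 F) := by
  have h := cupProduct_map_adjoint (P.coindFin N) P u r (𝟙 Z) (fun x ψ => by
    change (P.coindFin N).toLin (u.hom x) ψ = P.toLin x (r.hom ψ)
    rw [hr]
    exact P.coindFin_toLin_of_const N (u.hom x) x (hu x) ψ) a F
  rwa [cohomologyMap_id_apply] at h

end PairingGlobal

section PairingLocal

variable {R : Type u} [CommRing R] [TopologicalSpace R]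
variable {G : Type v} [Group G] [TopologicalSpace G] [IsTopologicalGroup G]
variable {D : Type v} [Group D] [TopologicalSpace D] [IsTopologicalGroup D] [LocallyCompactSpace D]
variable {X Y Z : TopRep.{v} R G} (P : ContPairing X Y Z) (N : Subgroup G) [Fintype (G ⧸ N)] (θ : D →ₜ* G)

omit [IsTopologicalGroup G] in
/-- **The unit and the trace are adjoint under the cup product, along `θ : D →ₜ* G`**: for a unit
`u_θ : X|_θ ⟶ Maps(G ⧸ N, X)|_θ` and a trace `r_θ : Maps(G ⧸ N, Y)|_θ ⟶ Y|_θ` over `D`, a LOCAL class `a' ∈ H¹(D, X|_θ)` and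
`F ∈ H¹(D, Maps(G ⧸ N, Y)|_θ)`: `H¹(u_θ) a' ∪_{(ΣP)|_θ} F = a' ∪_{P|_θ} H¹(r_θ) F`.
[cite: NeukirchSchmidtWingberg2008, I §5 Prop. (1.5.3)(iv)] -/
theorem cupProduct_coindFin_restrict_of_const
    (uθ : TopRep.res (θ : D →* G) X ⟶
      TopRep.res (θ : D →* G) (_root_.Literature.NumberTheory.GaloisRepresentations.coindFin X N))
    (hu : ∀ (x : X) (y : G ⧸ N), (uθ.hom x : G ⧸ N → X) y = x)
    (rθ : TopRep.res (θ : D →* G) (_root_.Literature.NumberTheory.GaloisRepresentations.coindFin Y N) ⟶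
      TopRep.res (θ : D →* G) Y)
    (hr : ∀ ψ : _root_.Literature.NumberTheory.GaloisRepresentations.coindFin Y N,
      rθ.hom ψ = ∑ y : G ⧸ N, (ψ : G ⧸ N → Y) y)
    (a' : continuousCohomology 1 (TopRep.res (θ : D →* G) X))
    (F : continuousCohomology 1
      (TopRep.res (θ : D →* G) (_root_.Literature.NumberTheory.GaloisRepresentations.coindFin Y N))) :
    ((P.coindFin N).restrict θ).cupProduct (cohomologyMap uθ 1 a') F =
      (P.restrict θ).cupProduct a' (cohomologyMap rθ 1 F) := by
  have h := cupProduct_map_adjoint ((P.coindFin N).restrict θ) (P.restrict θ) uθ rθ (𝟙 _) (fun x ψ => by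
    change (P.coindFin N).toLin (uθ.hom x) ψ = P.toLin x (rθ.hom ψ)
    rw [hr]
    exact P.coindFin_toLin_of_const N (uθ.hom x) x (hu x) ψ) a' F
  rwa [cohomologyMap_id_apply] at h

variable (hN : IsOpen (N : Set G)) {s : G ⧸ N → G} (hs : ∀ x : G ⧸ N, (s x : G ⧸ N) = x)
  (hs1 : s ((1 : G) : G ⧸ N) = 1)

/-- **`⟨u_* a', θ^*(Sh_N b)⟩_{ΣP} = ⟨a', θ^*(cor b)⟩_P`** — the projection formula of Neukirch–Schmidt–Wingberg (1.5.3)(iv)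
read at a place: for a LOCAL class `a' ∈ H¹(D, X|_θ)`, a LAYER class `b ∈ H¹(N, Y)`, a unit `u_θ`, a trace `r_θ`, and
identity-like comparison morphisms `jC`, `jY` used to write the localisations `θ^*` of the global classes
(`jC ψ = ψ`, `jY y = y`): `H¹(u_θ) a' ∪_{(ΣP)|_θ} H¹(θ, jC)(Sh_N b) = a' ∪_{P|_θ} H¹(θ, jY)(cor b)`
(`cupProduct_coindFin_restrict_of_const` + `cohomologyMap_of_sum_map_shapiroLift`). With `a' = z̃` a local class at an
auxiliary place and `b` a layer Selmer class this is `⟨u_* z̃, loc(Sh b)⟩ = ⟨z̃, loc(cor b)⟩`, the obstruction term of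
Poitou–Tate in the Shapiro model. [cite: NeukirchSchmidtWingberg2008, I §5 Prop. (1.5.3)(iv), I §6 Prop. (1.6.4)] -/
theorem cupProduct_const_map_shapiroLift
    (uθ : TopRep.res (θ : D →* G) X ⟶
      TopRep.res (θ : D →* G) (_root_.Literature.NumberTheory.GaloisRepresentations.coindFin X N))
    (hu : ∀ (x : X) (y : G ⧸ N), (uθ.hom x : G ⧸ N → X) y = x)
    (rθ : TopRep.res (θ : D →* G) (_root_.Literature.NumberTheory.GaloisRepresentations.coindFin Y N) ⟶
      TopRep.res (θ : D →* G) Y)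
    (hr : ∀ ψ : _root_.Literature.NumberTheory.GaloisRepresentations.coindFin Y N,
      rθ.hom ψ = ∑ y : G ⧸ N, (ψ : G ⧸ N → Y) y)
    (jC : TopRep.res (θ : D →* G) (_root_.Literature.NumberTheory.GaloisRepresentations.coindFin Y N) ⟶
      TopRep.res (θ : D →* G) (_root_.Literature.NumberTheory.GaloisRepresentations.coindFin Y N))
    (hjC : ∀ ψ, jC.hom ψ = ψ)
    (jY : TopRep.res (θ : D →* G) Y ⟶ TopRep.res (θ : D →* G) Y) (hjY : ∀ y, jY.hom y = y)
    (a' : continuousCohomology 1 (TopRep.res (θ : D →* G) X)) (b : continuousCohomology 1 (subgroupRep Y N)) :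
    ((P.coindFin N).restrict θ).cupProduct (cohomologyMap uθ 1 a')
        (ContinuousCohomology.map θ jC 1 (shapiroLift Y N hN hs hs1 b)) =
      (P.restrict θ).cupProduct a' (ContinuousCohomology.map θ jY 1 (cores Y N hN b)) := by
  rw [P.cupProduct_coindFin_restrict_of_const N θ uθ hu rθ hr,
    cohomologyMap_of_sum_map_shapiroLift Y N hN hs hs1 θ jC rθ jY (fun ψ => by rw [hjC, hr, hjY]) b]

end PairingLocal

end ContPairing

end Literature.NumberTheory.GaloisRepresentations

end
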